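import Literature.NumberTheory.EllipticCurves.HondaStrongIsomorphismAllPrimesProofs
import Literature.NumberTheory.EllipticCurves.HondaStrongIsomorphismMultiplicativeProofs
import Literature.NumberTheory.EllipticCurves.CuspidalReductionInfiniteHeightProofs
import Literature.NumberTheory.EllipticCurves.SigmaSqDivisionOfThetaProofs
import Literature.NumberTheory.EllipticCurves.FormalLogExpBaseChangeProofs
import Literature.NumberTheory.EllipticCurves.FormalGroupLaurentPoints
import Literature.NumberTheory.EllipticCurves.PadicFormalLogOrder
import Summits.BirchSwinnertonDyer.BirchSwinnertonDyer.Theorems.EisensteinDepletionAtTwoStarOptBNSFFormalSqrtAtTwo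
import HarnessLib

/-!
# Integrality of the formal modular-parametrisation parameter (line `nsf`, crux `StarOptBNSF`, stmt-BirchSwinnertonDyer-27047)

**The arithmetic half of stub S2 of line `nsf` (route A″), CLOSED from the tree's Honda theorems at EVERY prime.**
For a globally minimal elliptic `W/ℚ` with `L`-series coefficients `aₙ = aₙ(W)` (Mathlib `WeierstrassCurve.LFunction`)
put `ℓ(q) = Σₙ aₙ qⁿ/n ∈ ℚ⟦q⟧` and, for an integer `c`, `Z_c := exp_W(c·ℓ) ∈ ℚ⟦q⟧` (`exp_W = formalExp`, the formal
exponential of AEC IV.5).  Then **`Z_c ∈ ℤ⟦q⟧`** (`exists_int_coeff_formalExp_subst_lSeriesLog`).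

Along the `X₁(N)`-parametrisation `τ ↦ (℘_{L₁}(c₁u_f(τ)) − b₂/12, …)` of the lattice-optimal curve (`L₁ = c₁Λ₁(f)`, `c₁ ∈ ℤ`),
the local parameter `−x/y` has the expansion `Z_{c₁}(q)` (`u_f = Σ aₙqⁿ/n`, tree `hasSum_eichlerIntegral`; the Taylor series
of `−x/y` along the uniformisation is `exp_W`, tree `taylor_localParam_eq_formalExp`) — that analytic identification is the
other half of S2 and stays with the analytic stub.  THIS file is pure arithmetic: for every prime `p`, Honda's theorem
(1968 Thm. 5 / 1970 Thm. 9) — in the tree for good `p` (`exists_padicInt_formalLog_subst_eq_lSeriesLog'`), multiplicative `p`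
(`…_of_dvd_of_not_dvd`) and additive `p` (`…_of_dvd_of_dvd`, `p = 2, 3` included) — writes `ℓ = log_W(ψ)` with
`ψ ∈ qℤ_p⟦q⟧`, so `Z_c = exp_W(c·log_W ψ) = [c]_W(ψ)` (`[−c] = [c] ∘ i`) is `p`-integral (`formalExp_subst_nsmul_formalLog`,
`isPadicInt_formalMul`, `isPadicInt_formalNeg`); a rational number integral at every prime is an integer.
BSD is not proved by this file; nothing here reads `r_an`.
-/

set_option linter.dupNamespace false
set_option autoImplicit false

noncomputable section

open PowerSeries
open Literature.NumberTheory.EllipticCurves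

namespace Summit.BirchSwinnertonDyer.BirchSwinnertonDyer.Theorems.DepletionAtTwo.ParamIntegral

/-- **Honda at every prime** (assembly of the tree's three cases): for a globally minimal elliptic `W/ℚ` and ANY prime `p`
there is `ψ ∈ qℤ_p⟦q⟧` with `log_W(ψ) = Σ aₙ(W) qⁿ/n`. [cite: Honda1970, Thm. 9] [cite: Honda1968, Thm. 5] -/
theorem exists_hondaWitness (W : WeierstrassCurve ℚ) [W.IsElliptic] [W.IsGloballyMinimal] (p : ℕ) [Fact p.Prime] :
    ∃ ψ : ℚ_[p]⟦X⟧, constantCoeff ψ = 0 ∧ (∀ n, ‖coeff n ψ‖ ≤ 1) ∧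
      (W.map (algebraMap ℚ ℚ_[p])).formalLog.subst ψ =
        PowerSeries.mk fun k ↦ ((W.LFunction k : ℤ) : ℚ_[p]) / k := by
  by_cases hΔ : (p : ℤ) ∣ WeierstrassCurve.minimalDiscriminantInt W
  · by_cases hc4 : (p : ℤ) ∣ (WeierstrassCurve.integralModelInt W).c₄
    · exact W.exists_padicInt_formalLog_subst_eq_lSeriesLog_of_dvd_of_dvd hΔ hc4
    · exact W.exists_padicInt_formalLog_subst_eq_lSeriesLog_of_dvd_of_not_dvd hΔ hc4
  · exact W.exists_padicInt_formalLog_subst_eq_lSeriesLog' hΔ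

/-- `p`-integrality of `exp_W(c·ℓ)` over `ℚ_p`, `c ∈ ℤ`, from a Honda witness `ℓ = log_W(ψ)`:
`exp_W(c·log_W ψ) = [c](ψ)` for `c ≥ 0` and `= [−c](i(ψ))` for `c < 0`. [Silverman AEC IV.2.3, IV.5.5] [folklore] -/
theorem isPadicInt_formalExp_subst_zsmul {p : ℕ} [Fact p.Prime] (V : WeierstrassCurve ℚ_[p]) [V.IsIntegral ℤ_[p]]
    {ψ : ℚ_[p]⟦X⟧} (hψ0 : constantCoeff ψ = 0) (hψ : IsPadicInt ψ) (c : ℤ) :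
    IsPadicInt (V.formalExp.subst ((c : ℚ_[p]) • V.formalLog.subst ψ)) := by
  have hψs : HasSubst ψ := HasSubst.of_constantCoeff_zero' hψ0
  have hlogs : HasSubst V.formalLog := WeierstrassCurve.hasSubst_formalLog V
  -- `c = m` or `c = -m`
  obtain ⟨m, hm | hm⟩ := Int.eq_nat_or_neg c
  · -- `exp(m • log ψ) = [m](ψ)`
    have hsm : ((c : ℚ_[p]) • V.formalLog.subst ψ) = (m • V.formalLog).subst ψ := by
      rw [hm, Int.cast_natCast, Nat.cast_smul_eq_nsmul, ← coe_substAlgHom hψs, map_nsmul]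
    have hms : HasSubst (m • V.formalLog) :=
      HasSubst.of_constantCoeff_zero' (by rw [map_nsmul, WeierstrassCurve.constantCoeff_formalLog, nsmul_zero])
    rw [hsm, ← subst_comp_subst_apply hms hψs, WeierstrassCurve.formalExp_subst_nsmul_formalLog]
    exact (V.isPadicInt_formalMul m).powerSeries_subst hψ hψs
  · -- `exp(-m • log ψ) = [m](i ψ)`
    set ψ' : ℚ_[p]⟦X⟧ := V.formalNeg.subst ψ with hψ'
    have hψ'0 : constantCoeff ψ' = 0 := V.constantCoeff_formalNeg_subst hψ0
    have hψ's : HasSubst ψ' := HasSubst.of_constantCoeff_zero' hψ'0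
    have hψ'i : IsPadicInt ψ' := V.isPadicInt_formalNeg.powerSeries_subst hψ hψs
    have hnegs : HasSubst V.formalNeg := HasSubst.of_constantCoeff_zero' V.constantCoeff_formalNeg
    have hms : HasSubst (m • V.formalLog) :=
      HasSubst.of_constantCoeff_zero' (by rw [map_nsmul, WeierstrassCurve.constantCoeff_formalLog, nsmul_zero])
    have h1 : (m • V.formalLog).subst V.formalNeg = m • (-V.formalLog) := by
      rw [← V.formalLog_subst_formalNeg, ← coe_substAlgHom hnegs, map_nsmul]
    have h2 : (m • (-V.formalLog)).subst ψ = m • -(V.formalLog.subst ψ) := by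
      rw [← coe_substAlgHom hψs, map_nsmul, map_neg]
    have hsm : ((c : ℚ_[p]) • V.formalLog.subst ψ) = (m • V.formalLog).subst ψ' := by
      rw [hm, Int.cast_neg, Int.cast_natCast, neg_smul, Nat.cast_smul_eq_nsmul, hψ',
        ← subst_comp_subst_apply hnegs hψs, h1, h2, smul_neg]
    rw [hsm, ← subst_comp_subst_apply hms hψ's, WeierstrassCurve.formalExp_subst_nsmul_formalLog]
    exact (V.isPadicInt_formalMul m).powerSeries_subst hψ'i hψ's

/-- **`exp_W(c·Σ aₙqⁿ/n) ∈ ℤ⟦q⟧`** for a globally minimal elliptic `W/ℚ` and `c ∈ ℤ` — the arithmetic half of stub S2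
(`stub_paramIntegral`) of line `nsf`. [cite: Honda1970, Thm. 9] [cite: SilvermanAEC2009, IV.5.5] -/
theorem exists_int_coeff_formalExp_subst_lSeriesLog (W : WeierstrassCurve ℚ) [W.IsElliptic] [W.IsGloballyMinimal]
    (c : ℤ) (n : ℕ) : ∃ k : ℤ,
      coeff n (W.formalExp.subst
        ((c : ℚ) • (PowerSeries.mk fun j : ℕ ↦ ((W.LFunction j : ℤ) : ℚ) / j))) = (k : ℚ) := by
  set ℓ : ℚ⟦X⟧ := PowerSeries.mk fun j : ℕ ↦ ((W.LFunction j : ℤ) : ℚ) / j with hℓ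
  set Z : ℚ⟦X⟧ := W.formalExp.subst ((c : ℚ) • ℓ) with hZ
  have hℓ0 : constantCoeff ℓ = 0 := by
    rw [← coeff_zero_eq_constantCoeff_apply, hℓ, coeff_mk, Nat.cast_zero, div_zero]
  have hcℓ0 : constantCoeff ((c : ℚ) • ℓ) = 0 := by rw [smul_eq_C_mul, map_mul, hℓ0, mul_zero]
  have hcℓs : HasSubst ((c : ℚ) • ℓ) := HasSubst.of_constantCoeff_zero' hcℓ0
  -- integral at every prime
  obtain ⟨k, hk⟩ := Summit.BirchSwinnertonDyer.BirchSwinnertonDyer.Theorems.DepletionAtTwo.FormalSqrt.exists_int_of_forall_norm_le_one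
    (coeff n Z) (fun p _ ↦ by
      set φ : ℚ →+* ℚ_[p] := algebraMap ℚ ℚ_[p] with hφ
      haveI : (W.map φ).IsIntegral ℤ_[p] := by
        rw [hφ]
        change (W.baseChange ℚ_[p]).IsIntegral ℤ_[p]
        infer_instance
      obtain ⟨ψ, hψ0, hψi, hψ⟩ := exists_hondaWitness W p
      have hψi' : IsPadicInt ψ := isPadicInt_iff_coeff.mpr hψi
      -- `map φ Z = exp_{W ⊗ ℚ_p}(c • ℓ_p)` and `ℓ_p = log(ψ)`
      have hmapℓ : PowerSeries.map φ ((c : ℚ) • ℓ) = (c : ℚ_[p]) • (W.map φ).formalLog.subst ψ := by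
        rw [hψ]
        ext j
        rw [coeff_map, coeff_smul, coeff_smul, hℓ, coeff_mk, coeff_mk, smul_eq_mul, smul_eq_mul, map_mul,
          map_intCast, map_div₀, map_natCast, map_intCast]
      have hmapZ : PowerSeries.map φ Z = (W.map φ).formalExp.subst ((c : ℚ_[p]) • (W.map φ).formalLog.subst ψ) := by
        rw [hZ, ← hmapℓ, ← W.map_formalExp φ]
        exact PowerSeries.map_subst hcℓs W.formalExp
      have hint := isPadicInt_formalExp_subst_zsmul (W.map φ) hψ0 hψi' c
      rw [← hmapZ] at hint
      have := isPadicInt_iff_coeff.mp hint n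
      rw [coeff_map] at this
      simpa [hφ] using this)
  exact ⟨k, hk.symm⟩

/-- **Stub S2a of line `nsf` (v16), registered signature.** -/
theorem stub_paramIntegralFormal :
    ∀ (W : WeierstrassCurve ℚ) [W.IsElliptic] [W.IsGloballyMinimal] (c : ℤ) (n : ℕ), ∃ k : ℤ,
      PowerSeries.coeff n (W.formalExp.subst
        ((c : ℚ) • (PowerSeries.mk fun j : ℕ ↦ ((W.LFunction j : ℤ) : ℚ) / j))) = (k : ℚ) :=
  fun W _ _ c n ↦ exists_int_coeff_formalExp_subst_lSeriesLog W c n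

end Summit.BirchSwinnertonDyer.BirchSwinnertonDyer.Theorems.DepletionAtTwo.ParamIntegral

end
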